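import Summits.ValiantsHypothesis.ValiantsHypothesis.Theses.FermionicJet

/-!
# FermionicJet — FirstToBounded

`FirstOrderHardness` (cdet is not a VP family) is the `k = 1` instance of
`BoundedOrderHardness` (some fixed-order jet of the fermionic pencil is not a VP family):
the order-`k` jet has coefficient `sgn σ · C(c(σ), k)` and `C(c, 1) = c`, so the order-1 jet
family is literally cdet.  Closes item stmt-ValiantsHypothesis-5345 of
route-ValiantsHypothesis-FermionicJet.
-/

-- `Summit.ValiantsHypothesis.ValiantsHypothesis.…` is the tree's mandated single-conjunct layout
-- (Sub = Summit), so the duplicated namespace component is intended.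
set_option linter.dupNamespace false

namespace Summit.ValiantsHypothesis.ValiantsHypothesis.Theorems.FermionicJet

open Summit.ValiantsHypothesis.ValiantsHypothesis.Theses.FermionicJet

/-- **FirstToBounded** (route FermionicJet, item stmt-ValiantsHypothesis-5345): first-order
hardness of the fermionic pencil (cdet ∉ VP) gives bounded-order hardness, by taking the jet
order `k = 1` and using `Nat.choose c 1 = c`. -/
theorem firstToBounded_proof :
    Summit.ValiantsHypothesis.ValiantsHypothesis.Theses.FermionicJet.FirstToBounded := by
  unfold FirstToBounded FirstOrderHardness BoundedOrderHardness
  intro h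
  refine ⟨1, ?_⟩
  simpa only [Nat.choose_one_right] using h

end Summit.ValiantsHypothesis.ValiantsHypothesis.Theorems.FermionicJet
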